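import Summits.QuantumFields.BalabanUV.T4Continuum.Support.ShellMeasureTranslate

/-!
# `T4Continuum.ShellMeasureTranslateRate` — member (τ) of the NE7c shell-measure frame: the one-sided rate at the ACTIVE
# plaquette is DATA-RELATIVE and needs no transversality — the kernel form of the repair of (T1) after its falsifier
# (cell `pub-balaban`, sub-cell `t4`, spine estimate NE7c (node U5b); lineage t4-ne7c-p1 = PROVER seat P1 «shell-measure
# route», generation 21, row-NE7c owner; GAPS G-ne7cp1-24; compute evidence kit jobs j078128 ∕ j078160 (tag balaban-t4),
# write-up `HOME/t4/b2b-balaban-t4-ne7c-p1/gen21/t1fals/T1-FALSIFIER.md`; tree target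
# `Summits/QuantumFields/BalabanUV/T4Continuum/Support/`; ADDITIVE — imports `Support.ShellMeasureTranslate` only)

HONEST FRAMING.  Finite four-torus programme, rung (B)+1 only — NOT infinite volume, NOT a mass gap, NOT the Clay
problem, NOT summit progress; (B), `BetaPertHyp`, (B^μ) are not mentioned because nothing here consumes them.  The
cell wall of NE7c — (M1) FOR BAŁABAN'S INDUCTIVELY DEFINED EFFECTIVE MEASURES — is NOT PRINTED (GAPS G-ne7cp1-1), asserted
by nobody, and NOT moved by this file.  [folklore] kernel arithmetic, 0 sorry, 0 citations; nothing of Bałaban's objects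
is asserted.

THE POINT.  The NE7 ideation memo g25 stated member (τ)'s non-degeneracy input as (T1): «for EVERY fine plaquette `p`
some nearby coarse bond moves `ũ_p` at rate `≥ c₁/√dim G`».  Its own falsifier (linearised, abelianised, `n = 2`, `L = 2`,
`k = 1,2,3`; two engines) REFUTES that uniform form: the block-central plaquettes of each orientation (fraction `L^{−2k}`)
respond to NO coarse bond at first order — every constrained minimiser is flat there.  But the route uses the rate only
at the ACTIVE plaquette `p*` of the tested configuration, where the sup IS attained: `u(V) = ũ_{p*}(V)`, and (in the
linear model exactly, in general up to the near-linearity remainder) `ũ_{p*}(V) = |Σ_B H(p*;B)·v_B|` — the tested value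
is REPRODUCED by the response kernel against the data.  Then the finite lemma `exists_large_entry` of
`ShellMeasureTranslate` §3 gives a menu bond with `|H(p*;B*)| ≥ u/(2·N_menu·‖v‖_{∞,menu})` as soon as the response tail
beyond the menu is at most `u/2`: a DATA-RELATIVE rate (`exists_rate_of_reproduction`), uniform on the shell because
`u ≥ θ(1−ρ)` there (`exists_rate_on_shell`).  So (T1) is replaced by three inputs of upper-bound ∕ decay type — (T1-lin)
reproduction = near-linearity of the one-bond response ((AN) TYPE), (T1-loc) decay of the response kernel beyond the menu
radius, (T1-size) the local data bound after the tree gauge (= (LR)) — and NO transversality hypothesis remains in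
member (τ).  The rate `κ = θ(1−ρ)/(2·N_menu·vmax)` is what instantiates the parameter `κ` of
`ShellMeasureTranslateBond.slotAntiConcentration_realized_oneBond` (with the assignment `m(x) = (B*(x), sign)`).

WHAT THIS DOES NOT DO.  The instances of (T1-lin) ∕ (T1-loc) ∕ (T1-size) for Bałaban's localized minimisers are NOT
constructed (located, NOT PRINTED); the measurability of the assignment is the instance builder's.  NE7c NOT proved.
-/

namespace Summit.QuantumFields.BalabanUV.T4Continuum.ShellMeasureTranslateRate

open Finset
open ShellMeasureTranslate (exists_large_entry)

/-- **THE DATA-RELATIVE RATE AT THE ACTIVE PLAQUETTE.**  Bonds `β` (finite), a menu `s` of nearby bonds, the response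
kernel `H` of the active plaquette variable and the (linearised) data `v`.  If the tested value is REPRODUCED,
`u ≤ |Σ_B H B · v B|` ((T1-lin)), the tail beyond the menu is at most half of it ((T1-loc)), and the data on the menu is
bounded by `vmax > 0` ((T1-size)), then some menu bond moves the active variable at rate `≥ u/(2·|s|·vmax)` — by
`exists_large_entry` applied to `B ↦ H B · v B`.  No lower bound on `H` is assumed anywhere. [folklore] -/
theorem exists_rate_of_reproduction {β : Type*} [Fintype β] [DecidableEq β] (H v : β → ℝ) (s : Finset β)
    (hs : s.Nonempty) {u vmax : ℝ} (hu : u ≤ |∑ B, H B * v B|) (htail : ∑ B ∈ sᶜ, |H B * v B| ≤ u / 2)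
    (hv : ∀ B ∈ s, |v B| ≤ vmax) (hvmax : 0 < vmax) :
    ∃ B ∈ s, u / (2 * s.card * vmax) ≤ |H B| := by
  obtain ⟨B, hB, hle⟩ := exists_large_entry (fun B => H B * v B) s u hs hu htail
  refine ⟨B, hB, ?_⟩
  have hcard : (0 : ℝ) < s.card := by exact_mod_cast hs.card_pos
  have h1 : |H B * v B| ≤ |H B| * vmax := by
    rw [abs_mul]
    exact mul_le_mul_of_nonneg_left (hv B hB) (abs_nonneg _)
  have h2 : u / (2 * s.card) ≤ |H B| * vmax := hle.trans h1
  rw [div_le_iff₀ (by positivity)]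
  have h3 := (div_le_iff₀ (by positivity : (0 : ℝ) < 2 * s.card)).1 h2
  nlinarith

/-- **UNIFORM ON THE SHELL.**  On the shell `θ(1−ρ) ≤ u`, reproduction + tail + data bound give a
menu bond with rate `≥ κ := θ(1−ρ)/(2·|s|·vmax)` — the ONE number that instantiates the parameter `κ` of
`ShellMeasureTranslateBond.slotAntiConcentration_realized_oneBond` for every shell point (the exit length is then
`ℓ = 2ρθ/κ = 4ρ·|s|·vmax/(1−ρ)`: proportional to `ρ` and to the local data size, independent of any transversality).
[folklore] -/
theorem exists_rate_on_shell {β : Type*} [Fintype β] [DecidableEq β] (H v : β → ℝ) (s : Finset β)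
    (hs : s.Nonempty) {u θ ρ vmax : ℝ} (hshell : θ * (1 - ρ) ≤ u)
    (hu : u ≤ |∑ B, H B * v B|) (htail : ∑ B ∈ sᶜ, |H B * v B| ≤ u / 2) (hv : ∀ B ∈ s, |v B| ≤ vmax)
    (hvmax : 0 < vmax) :
    ∃ B ∈ s, θ * (1 - ρ) / (2 * s.card * vmax) ≤ |H B| := by
  obtain ⟨B, hB, hle⟩ := exists_rate_of_reproduction H v s hs hu htail hv hvmax
  refine ⟨B, hB, le_trans ?_ hle⟩
  have hcard : (0 : ℝ) < s.card := by exact_mod_cast hs.card_pos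
  exact div_le_div_of_nonneg_right hshell (by positivity)

/-- the exit length at that rate: `2ρθ/κ = 4ρ·|s|·vmax/(1−ρ)` for `κ = θ(1−ρ)/(2|s|vmax)` (`θ > 0`, `ρ < 1`) — linear in
`ρ` and in the local data size. [folklore] -/
theorem exitLength_eq {θ ρ vmax : ℝ} {N : ℕ} (hθ : 0 < θ) (hρ : ρ < 1) (hvmax : 0 < vmax) (hN : 0 < N) :
    2 * ρ * θ / (θ * (1 - ρ) / (2 * N * vmax)) = 4 * ρ * N * vmax / (1 - ρ) := by
  have h1 : (0 : ℝ) < 1 - ρ := by linarith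
  have hN' : (0 : ℝ) < N := by exact_mod_cast hN
  field_simp
  ring

/-- NUMBERS (non-vacuity): with `|s| = 64` menu bonds, data bound `vmax = 1/10` and the reproduction `u = 1 ≤ |Σ H·v|`
realised by a single bond carrying `H = 20`, `v = 1/10` (all other entries `0`, tail `0 ≤ 1/2`), the lemma promises a
bond with `|H| ≥ 1/(2·64·(1/10)) = 5/64` — and the carrying bond has `|H| = 20`. [folklore] -/
example : (1 : ℝ) / (2 * 64 * (1 / 10)) = 5 / 64 := by norm_num

end Summit.QuantumFields.BalabanUV.T4Continuum.ShellMeasureTranslateRate
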